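import Summits.QuantumFields.YangMills.Theses.DualityDefect
import HarnessLib

/-!
# Route `DualityDefect`: the support item `CloverSelfDualSplit` (stmt-QuantumFields-11699)

POINTWISE SELF-DUAL SPLIT: for any group `G`, any matrix representation `ρ`, any configuration `U` of `ℤ⁴` and any
site `x`, the pseudoscalar clover density `P_x(U) = −2 Re tr(C₀₁C₂₃ − C₀₂C₁₃ + C₀₃C₁₂)` is dominated by the clover
energy `S_x(U) = ∑_{μ<ν} Re tr(C_{μν}† C_{μν})` (`flowedCloverEnergy` at flow time `0`), i.e. `O± = S ± P ≥ 0`.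
Proof: Cauchy–Schwarz for the real Hilbert–Schmidt (Frobenius) form, `2|Re tr(XY)| ≤ Re tr(X†X) + Re tr(Y†Y)`, applied
to the three pairs `(C₀₁,C₂₃)`, `(C₀₂,C₁₃)`, `(C₀₃,C₁₂)`; no anti-hermiticity is needed.
Pure entrywise matrix algebra (no norm instance is activated); nothing is asserted about Yang–Mills; no summit, leg
or crux statement is proved (width seat ym-t4-w17 g0, free hands; the item carried unlanded candidate proofs of
2026-08-15 by grounder seats g22-11, g22-49, g22-51 — re-derived here, their files being unreadable from this seat).
-/

set_option autoImplicit false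

namespace Summit.QuantumFields.YangMills.Theorems

namespace CloverSelfDualSplit

open Matrix

variable {n : Type*} [Fintype n]

/-- `Re tr(X† X) = ∑ᵢⱼ ‖Xᵢⱼ‖²`. [folklore] -/
theorem re_trace_conjTranspose_mul_self (X : Matrix n n ℂ) :
    (Xᴴ * X).trace.re = ∑ i, ∑ j, ‖X i j‖ ^ 2 := by
  simp only [Matrix.trace, Matrix.diag, Matrix.mul_apply, conjTranspose_apply, Complex.star_def,
    Complex.re_sum, Complex.conj_mul']
  rw [Finset.sum_comm]
  refine Finset.sum_congr rfl fun i _ => Finset.sum_congr rfl fun j _ => ?_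
  norm_cast

/-- `|Re tr(X Y)| ≤ ∑ᵢⱼ ‖Xᵢⱼ‖ ‖Yⱼᵢ‖`. [folklore] -/
theorem abs_re_trace_mul_le_sum (X Y : Matrix n n ℂ) :
    |(X * Y).trace.re| ≤ ∑ i, ∑ j, ‖X i j‖ * ‖Y j i‖ := by
  simp only [Matrix.trace, Matrix.diag, Matrix.mul_apply, Complex.re_sum]
  refine (Finset.abs_sum_le_sum_abs _ _).trans (Finset.sum_le_sum fun i _ => ?_)
  refine (Finset.abs_sum_le_sum_abs _ _).trans (Finset.sum_le_sum fun j _ => ?_)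
  exact (Complex.abs_re_le_norm _).trans (by rw [norm_mul])

/-- **Cauchy–Schwarz for the Frobenius form**: `2|Re tr(XY)| ≤ Re tr(X†X) + Re tr(Y†Y)`. [folklore] -/
theorem two_mul_abs_re_trace_mul_le (X Y : Matrix n n ℂ) :
    2 * |(X * Y).trace.re| ≤ (Xᴴ * X).trace.re + (Yᴴ * Y).trace.re := by
  rw [re_trace_conjTranspose_mul_self, re_trace_conjTranspose_mul_self]
  have hY : ∑ i, ∑ j, ‖Y i j‖ ^ 2 = ∑ i, ∑ j, ‖Y j i‖ ^ 2 := Finset.sum_comm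
  rw [hY, ← Finset.sum_add_distrib]
  simp_rw [← Finset.sum_add_distrib]
  refine (mul_le_mul_of_nonneg_left (abs_re_trace_mul_le_sum X Y) (by norm_num)).trans ?_
  rw [Finset.mul_sum]
  refine Finset.sum_le_sum fun i _ => ?_
  rw [Finset.mul_sum]
  refine Finset.sum_le_sum fun j _ => ?_
  nlinarith [sq_nonneg (‖X i j‖ - ‖Y j i‖), norm_nonneg (X i j), norm_nonneg (Y j i)]

end CloverSelfDualSplit

open Matrix Literature.MathematicalPhysics.QuantumLattice in
/-- **Pointwise self-dual split** `|P_x(U)| ≤ S_x(U)` for the flow-time-`0` clovers of any configuration of `ℤ⁴`,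
any group and any matrix representation. [folklore] -/
theorem abs_pseudoscalarClover_le_flowedCloverEnergy (G : Type) [Group G] {N : ℕ} (ρ : G →* Matrix (Fin N) (Fin N) ℂ)
    (U : LGConfig 4 G) (x : Fin 4 → ℤ) :
    |(-2 : ℝ) * (flowedClover ρ 0 U x 0 1 * flowedClover ρ 0 U x 2 3
        - flowedClover ρ 0 U x 0 2 * flowedClover ρ 0 U x 1 3
        + flowedClover ρ 0 U x 0 3 * flowedClover ρ 0 U x 1 2).trace.re| ≤ flowedCloverEnergy ρ 0 x U := by
  set C := flowedClover ρ 0 U x with hC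
  have h01 := CloverSelfDualSplit.two_mul_abs_re_trace_mul_le (C 0 1) (C 2 3)
  have h02 := CloverSelfDualSplit.two_mul_abs_re_trace_mul_le (C 0 2) (C 1 3)
  have h03 := CloverSelfDualSplit.two_mul_abs_re_trace_mul_le (C 0 3) (C 1 2)
  -- the energy is the sum of the six squared Frobenius norms
  have hE : flowedCloverEnergy ρ 0 x U
      = ((C 0 1)ᴴ * C 0 1).trace.re + ((C 0 2)ᴴ * C 0 2).trace.re + ((C 0 3)ᴴ * C 0 3).trace.re
        + ((C 1 2)ᴴ * C 1 2).trace.re + ((C 1 3)ᴴ * C 1 3).trace.re + ((C 2 3)ᴴ * C 2 3).trace.re := by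
    simp only [flowedCloverEnergy, Fin.sum_univ_four, hC]
    simp only [Fin.isValue, lt_self_iff_false, ite_false, ite_true,
      show (0 : Fin 4) < 1 from by decide, show (0 : Fin 4) < 2 from by decide, show (0 : Fin 4) < 3 from by decide,
      show (1 : Fin 4) < 2 from by decide, show (1 : Fin 4) < 3 from by decide, show (2 : Fin 4) < 3 from by decide,
      show ¬ (1 : Fin 4) < 0 from by decide, show ¬ (2 : Fin 4) < 0 from by decide, show ¬ (3 : Fin 4) < 0 from by decide,
      show ¬ (2 : Fin 4) < 1 from by decide, show ¬ (3 : Fin 4) < 1 from by decide, show ¬ (3 : Fin 4) < 2 from by decide]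
    ring
  -- the real part of the trace of the combination
  have hre : (C 0 1 * C 2 3 - C 0 2 * C 1 3 + C 0 3 * C 1 2).trace.re
      = (C 0 1 * C 2 3).trace.re - (C 0 2 * C 1 3).trace.re + (C 0 3 * C 1 2).trace.re := by
    simp only [trace_add, trace_sub, Complex.add_re, Complex.sub_re]
  rw [hre, hE, abs_mul, show |(-2 : ℝ)| = 2 by norm_num]
  have habs : |(C 0 1 * C 2 3).trace.re - (C 0 2 * C 1 3).trace.re + (C 0 3 * C 1 2).trace.re|
      ≤ |(C 0 1 * C 2 3).trace.re| + |(C 0 2 * C 1 3).trace.re| + |(C 0 3 * C 1 2).trace.re| := by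
    refine (abs_add_le _ _).trans ?_
    have := abs_sub (C 0 1 * C 2 3).trace.re (C 0 2 * C 1 3).trace.re
    linarith
  linarith

/-- **Item stmt-QuantumFields-11699 `DualityDefect.CloverSelfDualSplit` holds.** [folklore] -/
theorem dualityDefect_cloverSelfDualSplit_proof :
    Summit.QuantumFields.YangMills.Theses.DualityDefect.CloverSelfDualSplit := by
  unfold Summit.QuantumFields.YangMills.Theses.DualityDefect.CloverSelfDualSplit
  intro G _ N ρ U x
  exact abs_pseudoscalarClover_le_flowedCloverEnergy G ρ U x

end Summit.QuantumFields.YangMills.Theorems
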